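import Mathlib

/-!
# PneNP / OverlapGapAlgebra — crux `SolvableImpliesStableSection` (stmt-PneNP-2463):
# the MONOTONE REPAIR block (17/·) — the opaque objects exist

Support for crux `stmt-PneNP-2463` (`Summit.PneNP.PneNP.Theses.OverlapGapAlgebra.SolvableImpliesStableSection`):
the f-free block "bounded-round monotone repair gives stable sections up to `α ≤ 2^k/(4k)`".
The block is written against opaque objects given with specifications (hypotheses `hval0`/`hvalS`
for the repair values, `hasm` for the assembling operation of tree codes, `hTS0`/`hTSs` for the
depth-indexed family of codes).  This file discharges them: each specification is satisfiable.

* `sissR_exists_val` — the monotone repair values (recursion on the round);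
* `sissR_exists_asm` — the assembling operation (root inserted into the shifted subtrees);
* `sissR_exists_TS` — the depth-indexed family (recursion on the depth, finitely many codes).
No definitions; axioms `propext`, `Classical.choice`, `Quot.sound`.
-/

set_option linter.dupNamespace false -- `Summit.PneNP.PneNP.…`: summit = sub-problem (D-0017)

namespace Summit.PneNP.PneNP.Theorems

open Finset
open scoped Classical

section Objects

variable {m k n : ℕ}

/-- **The repair values exist**: a `val : ℕ → instances → Fin n → Bool` with all variables `true` at
round `0` and the monotone-repair step. -/
theorem sissR_exists_val :
    ∃ val : ℕ → (Fin m → Fin k → Fin n × Bool) → Fin n → Bool, (∀ (Φ : (Fin m → Fin k → Fin n × Bool)) (v : Fin n), val 0 Φ v = true) ∧ (∀ (t : ℕ) (Φ : (Fin m → Fin k → Fin n × Bool)) (v : Fin n), val (t + 1) Φ v = true ↔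
      (val t Φ v = true ∧ ¬ (∃ ii : Fin m, (∀ jj : Fin k, val t Φ (Φ ii jj).1 ≠ (Φ ii jj).2) ∧
        ∃ jf : Fin k, (Φ ii jf).2 = false ∧ (∀ j' : Fin k, j' < jf → (Φ ii j').2 = true) ∧ (Φ ii jf).1 = v))) := by
  refine ⟨fun t => Nat.rec (motive := fun _ => (Fin m → Fin k → Fin n × Bool) → Fin n → Bool) (fun _ _ => true)
      (fun _ vt Φ v => vt Φ v && !decide (∃ ii : Fin m, (∀ jj : Fin k, vt Φ (Φ ii jj).1 ≠ (Φ ii jj).2) ∧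
        ∃ jf : Fin k, (Φ ii jf).2 = false ∧ (∀ j' : Fin k, j' < jf → (Φ ii j').2 = true) ∧
          (Φ ii jf).1 = v)) t,
    fun _ _ => rfl, fun t Φ v => ?_⟩
  show (_ && !decide _) = true ↔ _
  rw [Bool.and_eq_true, Bool.not_eq_true', decide_eq_false_iff_not]

/-- **The assembling operation exists.** -/
theorem sissR_exists_asm :
    ∃ asm : Fin m → ℕ → (Fin k → Option (Finset (List (Fin k) × (Fin m × ℕ)))) → Finset (List (Fin k) × (Fin m × ℕ)), ∀ (c : Fin m) (r : ℕ) (ch : Fin k → Option (Finset (List (Fin k) × (Fin m × ℕ))))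
      (e : (List (Fin k) × (Fin m × ℕ))), e ∈ asm c r ch ↔ (e = ([], (c, r)) ∨
      ∃ (j : Fin k) (S : Finset (List (Fin k) × (Fin m × ℕ))), ch j = some S ∧
        ∃ b : List (Fin k), (b, e.2) ∈ S ∧ e.1 = b ++ [j]) := by
  refine ⟨fun c r ch => insert (([] : List (Fin k)), (c, r))
    ((univ : Finset (Fin k)).biUnion fun j => ((ch j).getD ∅).image fun e => (e.1 ++ [j], e.2)),
    fun c r ch e => ?_⟩
  rw [Finset.mem_insert, Finset.mem_biUnion]
  refine or_congr Iff.rfl ⟨?_, ?_⟩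
  · rintro ⟨j, _, hj⟩
    rw [Finset.mem_image] at hj
    obtain ⟨e', he', hee⟩ := hj
    cases hS : ch j with
    | none => rw [hS] at he'; simp at he'
    | some S =>
      rw [hS] at he'
      refine ⟨j, S, hS, e'.1, ?_, ?_⟩
      · rw [← hee]; exact he'
      · rw [← hee]
  · rintro ⟨j, S, hS, b, hb, he⟩
    refine ⟨j, mem_univ _, ?_⟩
    rw [Finset.mem_image]
    refine ⟨(b, e.2), ?_, ?_⟩
    · rw [hS]; exact hb
    · ext1
      · exact he.symm
      · rfl

/-- **The depth-indexed family of codes exists** (for any assembling operation and round bound `L`). -/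
theorem sissR_exists_TS (asm : Fin m → ℕ → (Fin k → Option (Finset (List (Fin k) × (Fin m × ℕ)))) → Finset (List (Fin k) × (Fin m × ℕ))) (L : ℕ) :
    ∃ TS : ℕ → Finset (Finset (List (Fin k) × (Fin m × ℕ))), (∀ T : Finset (List (Fin k) × (Fin m × ℕ)), T ∈ TS 0 ↔
      ∃ (c : Fin m) (r : ℕ), r ≤ L ∧ T = asm c r (fun _ => none)) ∧ (∀ (d : ℕ) (T : Finset (List (Fin k) × (Fin m × ℕ))), T ∈ TS (d + 1) ↔
      ∃ (c : Fin m) (r : ℕ), r ≤ L ∧ ∃ ch : Fin k → Option (Finset (List (Fin k) × (Fin m × ℕ))),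
        (∀ (j : Fin k) (S : Finset (List (Fin k) × (Fin m × ℕ))), ch j = some S → S ∈ TS d) ∧ T = asm c r ch) := by
  refine ⟨fun d => Nat.rec (motive := fun _ => Finset (Finset (List (Fin k) × (Fin m × ℕ))))
      (((univ : Finset (Fin m)) ×ˢ Finset.range (L + 1)).image fun p => asm p.1 p.2 (fun _ => none))
      (fun _ S => ((univ : Finset (Fin m)) ×ˢ Finset.range (L + 1) ×ˢ
        Fintype.piFinset (fun _ : Fin k => insertNone S)).image fun p => asm p.1 p.2.1 p.2.2) d,
    fun T => ?_, fun d T => ?_⟩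
  · show T ∈ (((univ : Finset (Fin m)) ×ˢ Finset.range (L + 1)).image
      fun p => asm p.1 p.2 (fun _ => none)) ↔ _
    rw [Finset.mem_image]
    constructor
    · rintro ⟨⟨c, r⟩, hp, rfl⟩
      rw [Finset.mem_product, Finset.mem_range] at hp
      exact ⟨c, r, Nat.le_of_lt_succ hp.2, rfl⟩
    · rintro ⟨c, r, hr, rfl⟩
      exact ⟨(c, r), by rw [Finset.mem_product, Finset.mem_range]; exact ⟨mem_univ _, Nat.lt_succ_of_le hr⟩,
        rfl⟩
  · show T ∈ (((univ : Finset (Fin m)) ×ˢ Finset.range (L + 1) ×ˢ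
        Fintype.piFinset (fun _ : Fin k => insertNone _)).image fun p => asm p.1 p.2.1 p.2.2) ↔ _
    rw [Finset.mem_image]
    constructor
    · rintro ⟨⟨c, r, ch⟩, hp, rfl⟩
      rw [Finset.mem_product, Finset.mem_product, Finset.mem_range, Fintype.mem_piFinset] at hp
      refine ⟨c, r, Nat.le_of_lt_succ hp.2.1, ch, fun j S hS => ?_, rfl⟩
      have := hp.2.2 j
      dsimp only at this
      rw [hS, Finset.some_mem_insertNone] at this
      exact this
    · rintro ⟨c, r, hr, ch, hch, rfl⟩
      refine ⟨(c, r, ch), ?_, rfl⟩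
      rw [Finset.mem_product, Finset.mem_product, Finset.mem_range, Fintype.mem_piFinset]
      refine ⟨mem_univ _, Nat.lt_succ_of_le hr, fun j => ?_⟩
      show ch j ∈ insertNone _
      cases hS : ch j with
      | none => exact Finset.none_mem_insertNone
      | some S => rw [Finset.some_mem_insertNone]; exact hch j S hS

end Objects

end Summit.PneNP.PneNP.Theorems
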